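import Summits.BirchSwinnertonDyer.BirchSwinnertonDyer.Theorems.ThetaPartnerAtTwoSignedKatoUpToAtTwoKatoBKSocketHelpers
import HarnessLib

/-!
# Route `ThetaPartnerAtTwo` (TP2), crux K3 `SignedKatoDivisibilityUpToAtTwo` (stmt-BirchSwinnertonDyer-20308 / K3P′ 25631), line `colemanrat`
# v13 — helpers for the unit-tolerant socket CORE_KZ˟: a rational unit `u` in the layer-pairing clause is absorbed into Kato's constant

Width seat `bsd-wall-tp2-p2x-w3` g8 (cell `bsd-wall`). Small algebra used by `KatoBK.corePairChiPrim_of_coreKZU_of_bricks`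
(`…KatoBKSocketKZU.lean`): `τ • (u·Y) = u·(τ • Y)` for `u ∈ ℚ` and `τ ∈ Γ_{ℚ₂}`; Kato's `σ_b` character sums and plain sums are
`ℚ`-linear (`Σ_b ψ̄(b) σ_b(u·x) = u · Σ_b ψ̄(b) σ_b x`); hence brick B2 (primitive even character values) and brick B4c (trivial-character
values) for the RESCALED value `u · x_{n+2}` with the rescaled constant `u · q`. HONEST FRAMING: theorems only (no definition, no named
fact, no instance, no `sorry`); closes no item; K3 / K3P′ NOT settled; BSD is NOT proved by any of this.
-/

set_option autoImplicit false
-- the Theorems namespace of this sub repeats the summit name by design (D-0017 nested layout)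
set_option linter.dupNamespace false

noncomputable section

set_option backward.isDefEq.respectTransparency false

open scoped Classical MatrixGroups ModularForm NumberField TensorProduct

open CongruenceSubgroup WeierstrassCurve Field IsDedekindDomain NumberField
  Literature.NumberTheory.GaloisRepresentations
  Literature.NumberTheory.EllipticCurves Literature.NumberTheory.EllipticCurves.ModularForms
  Literature.NumberTheory.EllipticCurves.Module Literature.NumberTheory.EllipticCurves.Rank1Residual
  Literature.NumberTheory.EllipticCurves.Kobayashi2003 Literature.NumberTheory.EllipticCurves.Kato2004
  Literature.NumberTheory.EllipticCurves.Kato2004.EulerSystemValues Literature.NumberTheory.EllipticCurves.GreenbergSelmer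
  Literature.NumberTheory.EllipticCurves.Sprung2012
  Literature.NumberTheory.EllipticCurves.FormalGroupChart
  ZpExtension Summit.BirchSwinnertonDyer.Rank1Residual.Supersingular
  Summit.BirchSwinnertonDyer.Rank1Residual.Additive Summit.BirchSwinnertonDyer.Rank1Residual.Additive.PadicCyclotomicTower
  Summit.BirchSwinnertonDyer.Rank1Residual.Additive.BallEval
  Summit.BirchSwinnertonDyer.BirchSwinnertonDyer.Theorems.SignedKatoOffTwo.LocalTwo

namespace Summit.BirchSwinnertonDyer.BirchSwinnertonDyer.Theorems.SignedKatoOffTwo.KatoBK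

/-- `τ • (u · Y) = u · (τ • Y)`: the Galois action of `Γ_{ℚ₂}` on `ℚ̄₂` is by `ℚ₂`-algebra automorphisms, so it fixes rational constants.
[folklore] -/
theorem smul_ratCast_mul (ρ : Field.absoluteGaloisGroup ℚ_[2]) (u : ℚ) (Y : PadicAlgCl 2) :
    ρ • ((u : PadicAlgCl 2) * Y) = (u : PadicAlgCl 2) * ρ • Y := by
  rw [Field.absoluteGaloisGroup.smul_def, Field.absoluteGaloisGroup.smul_def, map_mul, map_ratCast]

/-- `u · (τ • (P · E)) = τ • (P · (u · E))` for a rational constant `u` — the summand-wise form in which the unit of the pairing clause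
is moved onto Kato's value. [folklore] -/
theorem ratCast_mul_smul_mul (ρ : Field.absoluteGaloisGroup ℚ_[2]) (u : ℚ) (P E : PadicAlgCl 2) :
    (u : PadicAlgCl 2) * ρ • (P * E) = ρ • (P * ((u : PadicAlgCl 2) * E)) := by
  rw [mul_left_comm P (u : PadicAlgCl 2) E, smul_ratCast_mul]

/-- `Σ_b σ_b (u · y) = u · Σ_b σ_b y`: Kato's `σ_b` are `ℚ`-algebra maps. [cite: Kato2004Asterisque, (5.7.1) (p. 157)] -/
theorem sum_sigma_ratCast_mul {M : ℕ} [NeZero M] (u : ℚ) (y : CyclotomicField M ℚ) :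
    ∑ b : (ZMod M)ˣ, sigma M b ((u : CyclotomicField M ℚ) * y) =
      (u : CyclotomicField M ℚ) * ∑ b : (ZMod M)ˣ, sigma M b y := by
  rw [Finset.mul_sum]
  refine Finset.sum_congr rfl fun b _ ↦ ?_
  rw [map_mul, map_ratCast]

/-- `Σ_b ψ̄(b) σ_b (u · y) = u · Σ_b ψ̄(b) σ_b y` (character sums are `ℚ`-linear). [cite: Kato2004Asterisque, Thm. 6.6 (1) (p. 163)] -/
theorem sum_mul_sigma_ratCast_mul {M : ℕ} [NeZero M] (ψF : DirichletCharacter (CyclotomicField M ℚ) M) (u : ℚ)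
    (y : CyclotomicField M ℚ) :
    ∑ b : (ZMod M)ˣ, ψF⁻¹ (b : ZMod M) * sigma M b ((u : CyclotomicField M ℚ) * y) =
      (u : CyclotomicField M ℚ) * ∑ b : (ZMod M)ˣ, ψF⁻¹ (b : ZMod M) * sigma M b y := by
  rw [Finset.mul_sum]
  refine Finset.sum_congr rfl fun b _ ↦ ?_
  rw [map_mul, map_ratCast, mul_left_comm]

/-- **(B2) for the rescaled Kato value `u · x_{n+2}` with constant `u · q`** (`xF` names `x_{n+2,∅}` at the syntactic level type; from
`charSumF_mul_gaussSum_eq_two` by `ℚ`-linearity of the character sum). [cite: Kato2004Asterisque, Thm. 6.6 (1), Thm. 9.7] -/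
theorem charSumF_mul_gaussSum_eq_two_ratMul {W : WeierstrassCurve ℚ} [W.IsElliptic] {N : ℕ} [NeZero N] {f : CuspForm (Gamma0 N) 2}
    (hf : IsNewformOf W f)
    [ContinuousSMul ℤ_[2] (W.tateModule 2)] [Module.Free ℤ_[2] (W.tateModule 2)] [Module.Finite ℤ_[2] (W.tateModule 2)]
    {ιC : (m : ℕ) → (CyclotomicField m ℚ →+* ℂ)} {κK : ℝ}
    {ΛK : ∀ (k : ℕ) (r : Finset (HeightOneSpectrum (𝓞 ℚ))),
      H1 (tateRep W 2) (cycSubgroup 2 k r) →ₗ[ℤ_[2]] ℚ_[2] ⊗[ℚ] CyclotomicField (cycLevel 2 k r) ℚ}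
    {c dd a : ℤ} {ee : ℕ}
    {z : ∀ (k : ℕ) (r : (cyclotomicLevelsRat 2 (badPlaces c dd (2 ^ ee) N)).Ideals),
      H1 (tateRep W 2) ((cyclotomicLevelsRat 2 (badPlaces c dd (2 ^ ee) N)).level k r.1)}
    {x : ∀ (k : ℕ) (r : (cyclotomicLevelsRat 2 (badPlaces c dd (2 ^ ee) N)).Ideals), CyclotomicField (cycLevel 2 k r.1) ℚ}
    (hbody : ZetaBody W 2 f ιC κK ΛK c dd a (2 ^ ee) z x) {q : ℚ} (hq : κK = q)
    (hcodd : ¬ (2 : ℤ) ∣ c) (hdodd : ¬ (2 : ℤ) ∣ dd) (d' : ℤ) (hdd' : dd * d' ≡ 1 [ZMOD ((2 ^ ee : ℕ) : ℤ)])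
    {n : ℕ}
    (hιC : ιC (cycLevel 2 (n + 2) (∅ : Finset (HeightOneSpectrum (𝓞 ℚ))))
        (IsCyclotomicExtension.zeta (cycLevel 2 (n + 2) (∅ : Finset (HeightOneSpectrum (𝓞 ℚ)))) ℚ
          (CyclotomicField (cycLevel 2 (n + 2) (∅ : Finset (HeightOneSpectrum (𝓞 ℚ)))) ℚ)) =
      Complex.exp (2 * Real.pi * Complex.I / (cycLevel 2 (n + 2) (∅ : Finset (HeightOneSpectrum (𝓞 ℚ))) : ℕ)))
    (u : ℚ) (xF : CyclotomicField (cycLevel 2 (n + 2) (∅ : Finset (HeightOneSpectrum (𝓞 ℚ)))) ℚ)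
    (hxF : xF = x (n + 2) (cyclotomicLevelsRat 2 (badPlaces c dd (2 ^ ee) N)).idealOne) :
    ∀ ψF : DirichletCharacter (CyclotomicField (cycLevel 2 (n + 2) (∅ : Finset (HeightOneSpectrum (𝓞 ℚ)))) ℚ)
      (cycLevel 2 (n + 2) (∅ : Finset (HeightOneSpectrum (𝓞 ℚ)))), ψF (-1) = 1 → ψF.IsPrimitive →
      (∑ b : (ZMod (cycLevel 2 (n + 2) (∅ : Finset (HeightOneSpectrum (𝓞 ℚ)))))ˣ,
          ψF⁻¹ (b : ZMod _) * sigma (cycLevel 2 (n + 2) (∅ : Finset (HeightOneSpectrum (𝓞 ℚ)))) b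
            ((u : CyclotomicField (cycLevel 2 (n + 2) (∅ : Finset (HeightOneSpectrum (𝓞 ℚ)))) ℚ) * xF)) *
          gaussSum ψF (AddChar.zmodChar (cycLevel 2 (n + 2) (∅ : Finset (HeightOneSpectrum (𝓞 ℚ))))
            (IsCyclotomicExtension.zeta_pow (cycLevel 2 (n + 2) (∅ : Finset (HeightOneSpectrum (𝓞 ℚ)))) ℚ
              (CyclotomicField (cycLevel 2 (n + 2) (∅ : Finset (HeightOneSpectrum (𝓞 ℚ)))) ℚ))) =
        ((u * q : ℚ) : CyclotomicField (cycLevel 2 (n + 2) ∅) ℚ) * ratTwistedSymbolSum f ψF *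
          ((c : CyclotomicField (cycLevel 2 (n + 2) ∅) ℚ) ^ 2 * (dd : CyclotomicField (cycLevel 2 (n + 2) ∅) ℚ) ^ 2 *
              ((ratMinusSymbol f ((a : ℚ) / (2 ^ ee : ℕ)) : ℚ) : CyclotomicField (cycLevel 2 (n + 2) ∅) ℚ)
            - (c : CyclotomicField (cycLevel 2 (n + 2) ∅) ℚ) * (dd : CyclotomicField (cycLevel 2 (n + 2) ∅) ℚ) ^ 2 *
              ψF (c : ZMod _) * ((ratMinusSymbol f ((a * c : ℚ) / (2 ^ ee : ℕ)) : ℚ) : CyclotomicField (cycLevel 2 (n + 2) ∅) ℚ)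
            - (c : CyclotomicField (cycLevel 2 (n + 2) ∅) ℚ) ^ 2 * (dd : CyclotomicField (cycLevel 2 (n + 2) ∅) ℚ) *
              ψF (dd : ZMod _) * ((ratMinusSymbol f ((a * d' : ℚ) / (2 ^ ee : ℕ)) : ℚ) : CyclotomicField (cycLevel 2 (n + 2) ∅) ℚ)
            + (c : CyclotomicField (cycLevel 2 (n + 2) ∅) ℚ) * (dd : CyclotomicField (cycLevel 2 (n + 2) ∅) ℚ) *
              (ψF (c : ZMod _) * ψF (dd : ZMod _)) *
              ((ratMinusSymbol f ((a * c * d' : ℚ) / (2 ^ ee : ℕ)) : ℚ) : CyclotomicField (cycLevel 2 (n + 2) ∅) ℚ)) := by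
  intro ψF hev hψ
  have h := charSumF_mul_gaussSum_eq_two hf hbody hq hcodd hdodd d' hdd' hιC ψF hev hψ
  rw [← hxF] at h
  rw [sum_mul_sigma_ratCast_mul, mul_assoc, h, Rat.cast_mul]
  ring

end Summit.BirchSwinnertonDyer.BirchSwinnertonDyer.Theorems.SignedKatoOffTwo.KatoBK

end
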